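import Summits.QuantumFields.BalabanUV.T4Continuum.Support.ShellMeasureRootCompositionHistories

/-!
# `T4Continuum.ShellMeasureRootCompositionHistoriesEnd` — file 2∕2 of the history-indexed (R)+[dict] push: the plug
# into END-I's one-run ledger and END-I FIRED at every level — `ShellWeightBound` ⇐ measurability + closeness + (M1) per
# slot per run FOR THE `s`-SMALL PARTIAL LAWS + (W1) + `D ≤ D̄` + rate, the twelve (R)+[dict] binders DISCHARGED
# (cell `pub-balaban`, sub-cell `t4`, spine estimate NE7c (node U5b); NE7c ROUND-2 crew `t4-ne7c-formalise-*`, unit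
# `b2b-balaban-t4-ne7c-formalise-leaf-05` gen 2; OFFERED row (journal l.7065); ADDITIVE — imports file 1
# `ShellMeasureRootCompositionHistories` only; 0 def, 0 sorry, 0 cite)

HONEST FRAMING.  Finite four-torus programme, rung (B)+1 only — NOT infinite volume, NOT a mass gap, NOT the Clay
problem, NOT summit progress.  NE7c = `T4IndicatorShell.ShellWeightBound` is NOT PRINTED in [Balaban 1983–89] and NOT
PROVED; END-I (`ShellMeasureRootComposition.shellWeightBound_of_slotAC`, p207618) is the COMPOSITION «NE7c ⇐ the named
binders» (trigger c3).  File 1 proved its six per-run (R)+[dict] binders, at every level and with `M ≡ 1`, for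
HISTORY-INDEXED term families of B14 (2.17)–(2.18) TYPE with history-dependent positive weights `ν_τ`, the realized
measure of a live slot `s` being its `s`-SMALL PARTIAL LAW `Σ_{τ∋s} smallProd_τ · ν_τ` (own indicator kept, file 1 §0).
This file: §4 the plug `levelLedger_histories` (⇐ measurability, `small ⊆ C`, a.e. closeness BY LEVEL — referee DV-6's
U1b∕NE3-type INPUT, displayed —, signs, THE WALL (M1) PER SLOT FOR ITS PARTIAL LAW), `hac_of_histories` ((M1) per
(slot, history ∋ slot) for `smallProd_τ · ν_τ` ⇒ the wall, by file 1 §1 — ONE displayed route, valid where a supplier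
reaches single histories), `omega_histories` (`ω K = Σ_{s∈C K} D_{lvl s}ρ_{lvl s}` = E1's summand); §5 END-I FIRED for two
runs on the common spaces: `shellWeightBound_histories` (rate form) and `shellWeightBound_histories_band` (road P2's
band form, c6) conclude LITERALLY `T4IndicatorShell.ShellWeightBound l₀ T A B shA shB (E1's Wsh)`.

CENSUS EFFECT (c3-honest).  For term families of this TYPE the [dict] push and the [dict] constants `M` leave NE7c's
displayed list at every level, and SM-L6 (MR) is no longer a ROOT binder: it survives SUPPLIER-SIDE only, as the question
for which laws (M1) can be delivered — per history (then `hac_of_histories`) where the history's co-factors are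
centre-monotone ∕ blind (rows S2 file 2, S15, S19), else through `T4ShellMeasureFibre.slotAntiConcentration_of_dominated`
with a displayed ratio.  Displayed at the root after these files: measurability, closeness by level (U1b-type), (M1) per
slot per run for the partial laws (THE wall; at live levels its content is SM-L1…SM-L5 through END-II), (W1) + count
(S9), `D ≤ D̄`, the rate (U1b).  NE7c NOT proved; 0/9 spine.  HONEST DEPENDENCY (cell): continuum YM on T⁴ ⇐ BetaPertH ∧
nine spine estimates (0/9 proved); BetaPertH ⇐ (D1) ∧ (D4) ∧ CAP+tail; G-an2-4 gates asym, D1 and NE2/3/4.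
-/

noncomputable section

open MeasureTheory Finset Filter
open scoped ENNReal

namespace Summit.QuantumFields.BalabanUV.T4Continuum.ShellMeasureRootCompositionHistoriesEnd

open Literature.MathematicalPhysics.QuantumFieldTheory.Balaban1983to89
open ShellMeasureRootCompositionHistories
open T4IndicatorShell (ShellWeightBound)
open T4ShellMeasure (SlotAntiConcentration)
open T4ShellMeasureLevels (LevelLedger LiveWindow)
open ShellMeasureRootComposition (levelLedger_of_slotAC shellWeightBound_of_slotAC shellWeightBound_of_slotAC_band)


/-! ## §4 The plug into END-I's one-run ledger: only (M1) per slot FOR ITS PARTIAL LAW stays displayed -/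

section Plug

variable {Ω : ℕ → Type*} [∀ K, MeasurableSpace (Ω K)] {σ ι : Type*} [DecidableEq σ] {T : ℕ → Finset ι}
  {C : ℕ → Finset σ} {small : ℕ → ι → Finset σ} {lvl : ℕ → σ → ℕ} {ν : ∀ K : ℕ, ℝ → ι → Measure (Ω K)}
  [∀ K t τ, IsFiniteMeasure (ν K t τ)] {uA uB : ∀ K : ℕ, ℝ → σ → Ω K → ℝ} {θ ρ D : ℕ → ℝ} {l₀ : ℝ}

omit [∀ K t τ, IsFiniteMeasure (ν K t τ)] in
/-- **(M1) FOR A PARTIAL LAW FROM (M1) PER HISTORY** (file 1 §1): if every history `τ ∋ s` has its law `smallProd_τ · ν_τ`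
anti-concentrated along `u^A_s` at the slot's level, so is the `s`-small partial law — ONE displayed route to the wall
(valid where a supplier reaches the single histories; nothing asserted). [folklore] -/
theorem hac_of_histories
    (hach : ∀ K t, |t| ≤ l₀ → ∀ s ∈ C K, ∀ τ ∈ T K, s ∈ small K τ →
      SlotAntiConcentration (histLaw (ν K t τ) (small K τ) (uA K t) (fun s => θ (lvl K s))) (uA K t s)
        (θ (lvl K s)) (ρ (lvl K s)) (D (lvl K s))) :
    ∀ K t, |t| ≤ l₀ → ∀ s ∈ C K,
      SlotAntiConcentration (partialLaw (T K) (ν K t) (small K) (uA K t) (fun s => θ (lvl K s)) s) (uA K t s)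
        (θ (lvl K s)) (ρ (lvl K s)) (D (lvl K s)) :=
  fun K t ht s hs => slotAntiConcentration_finsetSum _ _ fun τ hτ =>
    hach K t ht s hs τ (Finset.mem_filter.1 hτ).1 (Finset.mem_filter.1 hτ).2

/-- **EVERY LEVEL, HISTORY-INDEXED TERMS: `LevelLedger` ⇐ (M1) PER SLOT FOR ITS PARTIAL LAW.**  Terms `T K` with
weights `histWeight`, shell parts `histShell`, live slots `C K` at levels `lvl K s` with pieces `histPiece`, the realized
measure of slot `s` = its `s`-small partial law, tested variable `u^A_{K,t,s}`, `M ≡ 1`: the six per-run binders of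
`ShellMeasureRootComposition.levelLedger_of_slotAC` are THEOREMS (§3), so `T4ShellMeasureLevels.LevelLedger` follows from
measurability of both runs' tested variables, `small ⊆ C`, the a.e. closeness BY LEVEL, signs `0 ≤ D, ρ`, and THE WALL
(M1) PER SLOT `hac`.  CONDITIONAL on `hac`; nothing printed asserted. [folklore] -/
theorem levelLedger_histories (huA : ∀ K t s, Measurable (uA K t s)) (huB : ∀ K t s, Measurable (uB K t s))
    (hsmall : ∀ K, ∀ τ ∈ T K, small K τ ⊆ C K)
    (hclose : ∀ K t, |t| ≤ l₀ → ∀ τ ∈ T K, ∀ s ∈ small K τ,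
      ∀ᵐ ω ∂(ν K t τ), |uA K t s ω - uB K t s ω| ≤ ρ (lvl K s) * θ (lvl K s))
    (hD : ∀ j, 0 ≤ D j) (hρ : ∀ j, 0 ≤ ρ j)
    (hac : ∀ K t, |t| ≤ l₀ → ∀ s ∈ C K,
      SlotAntiConcentration (partialLaw (T K) (ν K t) (small K) (uA K t) (fun s => θ (lvl K s)) s) (uA K t s)
        (θ (lvl K s)) (ρ (lvl K s)) (D (lvl K s))) :
    LevelLedger l₀ T (fun K t τ => histWeight (ν K t τ) (small K τ) (uA K t) (fun s => θ (lvl K s)))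
      (fun K t τ => histShell (ν K t τ) (small K τ) (uA K t) (uB K t) (fun s => θ (lvl K s))) C
      (fun K t s τ => histPiece (ν K t τ) (small K τ) (uA K t) (uB K t) (fun s => θ (lvl K s)) s) lvl D ρ := by
  haveI : ∀ K t s, IsFiniteMeasure (partialLaw (T K) (ν K t) (small K) (uA K t) (fun s => θ (lvl K s)) s) :=
    fun K t s => isFiniteMeasure_partialLaw _ _ _ _ _ _
  exact levelLedger_of_slotAC (Ω := fun K _ => Ω K)
    (μ := fun K t s => partialLaw (T K) (ν K t) (small K) (uA K t) (fun s => θ (lvl K s)) s)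
    (u := fun K t s => uA K t s) (θ := θ) (M := fun _ _ _ => (1 : ℝ))
    (sh_nonneg T small lvl ν uA uB θ l₀) (sh_le T small lvl ν uA uB θ l₀ huA)
    (cover T C small lvl ν uA uB θ l₀ huA huB hsmall) (ShellMeasureRootCompositionPushCubes.M_nonneg C l₀)
    (piece_le T C small lvl ν uA uB θ ρ l₀ huA hclose) (total_ge T C small lvl ν uA θ l₀ huA) hD hρ hac

/-- the relative shell weight this ledger books at cutoff `K` is E1's summand `ω K = Σ_{s∈C K} D_{lvl s}·ρ_{lvl s}`
(geometric in `K` under (W1) + rate: `T4ShellMeasureLevels.LevelLedger.omega_le`). [folklore] -/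
theorem omega_histories (huA : ∀ K t s, Measurable (uA K t s)) (huB : ∀ K t s, Measurable (uB K t s))
    (hsmall : ∀ K, ∀ τ ∈ T K, small K τ ⊆ C K)
    (hclose : ∀ K t, |t| ≤ l₀ → ∀ τ ∈ T K, ∀ s ∈ small K τ,
      ∀ᵐ ω ∂(ν K t τ), |uA K t s ω - uB K t s ω| ≤ ρ (lvl K s) * θ (lvl K s))
    (hD : ∀ j, 0 ≤ D j) (hρ : ∀ j, 0 ≤ ρ j)
    (hac : ∀ K t, |t| ≤ l₀ → ∀ s ∈ C K,
      SlotAntiConcentration (partialLaw (T K) (ν K t) (small K) (uA K t) (fun s => θ (lvl K s)) s) (uA K t s)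
        (θ (lvl K s)) (ρ (lvl K s)) (D (lvl K s))) (K : ℕ) :
    (levelLedger_histories huA huB hsmall hclose hD hρ hac).toSlotLedger.omega K =
      ∑ s ∈ C K, D (lvl K s) * ρ (lvl K s) :=
  T4ShellMeasureLevels.LevelLedger.omega_eq (levelLedger_histories huA huB hsmall hclose hD hρ hac) K

end Plug

/-! ## §5 END-I FIRED: two runs, history-indexed terms, every (R)+[dict] binder discharged -/

section TwoRuns

variable {Ω : ℕ → Type*} [∀ K, MeasurableSpace (Ω K)] {σ ι : Type*} [DecidableEq σ] {T : ℕ → Finset ι}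
  {C : ℕ → Finset σ} {small : ℕ → ι → Finset σ} {lvl : ℕ → σ → ℕ} {νA νB : ∀ K : ℕ, ℝ → ι → Measure (Ω K)}
  [∀ K t τ, IsFiniteMeasure (νA K t τ)] [∀ K t τ, IsFiniteMeasure (νB K t τ)]
  {uA uB : ∀ K : ℕ, ℝ → σ → Ω K → ℝ} {θ ρ DA DB : ℕ → ℝ} {l₀ : ℝ} {N₁ : ℕ} {νbar Dbar c₁ ϑ : ℝ} {m : ℕ → ℝ}

/-- **END-I FOR HISTORY-INDEXED TERM FAMILIES — `ShellWeightBound` ⇐ measurability + closeness + (M1) per slot per run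
FOR THE PARTIAL LAWS + (W1) + `D ≤ D̄` + rate.**  Two runs on the common spaces `Ω K`: common histories `T K`, live slots
`C K ⊇ small K τ`, levels `lvl`, thresholds∕widths `θ_j`∕`ρ_j`; per run its history weights `ν^X` and tested variables
`u^X`, (M1) constants `D^X_j`.  All twelve (R)+[dict] binders of `ShellMeasureRootComposition.shellWeightBound_of_slotAC`
are supplied by §3; displayed remain: the a.e. closeness under each run's weights (DV-6, U1b-type, BY LEVEL), THE WALL
(M1) per slot per run for the `s`-small partial laws, the window `LiveWindow C lvl N₁ ν̄` (SM-L7, row S9), `D ≤ D̄`, and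
the rate `ρ_j ≤ c₁ϑ^j` (SM-L8, node U1b BY NAME — no NE7c seat proves it, c4).  CONCLUSION: LITERALLY
`T4IndicatorShell.ShellWeightBound l₀ T A B shA shB Wsh` with E1's `Wsh`.  CONDITIONAL; nothing printed asserted.
[folklore] -/
theorem shellWeightBound_histories (huA : ∀ K t s, Measurable (uA K t s)) (huB : ∀ K t s, Measurable (uB K t s))
    (hsmall : ∀ K, ∀ τ ∈ T K, small K τ ⊆ C K)
    (hcloseA : ∀ K t, |t| ≤ l₀ → ∀ τ ∈ T K, ∀ s ∈ small K τ,
      ∀ᵐ ω ∂(νA K t τ), |uA K t s ω - uB K t s ω| ≤ ρ (lvl K s) * θ (lvl K s))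
    (hcloseB : ∀ K t, |t| ≤ l₀ → ∀ τ ∈ T K, ∀ s ∈ small K τ,
      ∀ᵐ ω ∂(νB K t τ), |uB K t s ω - uA K t s ω| ≤ ρ (lvl K s) * θ (lvl K s))
    (hDA0 : ∀ j, 0 ≤ DA j) (hDB0 : ∀ j, 0 ≤ DB j) (hρ0 : ∀ j, 0 ≤ ρ j)
    (hacA : ∀ K t, |t| ≤ l₀ → ∀ s ∈ C K,
      SlotAntiConcentration (partialLaw (T K) (νA K t) (small K) (uA K t) (fun s => θ (lvl K s)) s) (uA K t s)
        (θ (lvl K s)) (ρ (lvl K s)) (DA (lvl K s)))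
    (hacB : ∀ K t, |t| ≤ l₀ → ∀ s ∈ C K,
      SlotAntiConcentration (partialLaw (T K) (νB K t) (small K) (uB K t) (fun s => θ (lvl K s)) s) (uB K t s)
        (θ (lvl K s)) (ρ (lvl K s)) (DB (lvl K s)))
    (hw : LiveWindow C lvl N₁ νbar) (hϑ0 : 0 < ϑ) (hϑ1 : ϑ < 1)
    (hDA : ∀ j, DA j ≤ Dbar) (hDB : ∀ j, DB j ≤ Dbar) (hrate : ∀ j, ρ j ≤ c₁ * ϑ ^ j) :
    ShellWeightBound l₀ T
      (fun K t τ => histWeight (νA K t τ) (small K τ) (uA K t) (fun s => θ (lvl K s)))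
      (fun K t τ => histWeight (νB K t τ) (small K τ) (uB K t) (fun s => θ (lvl K s)))
      (fun K t τ => histShell (νA K t τ) (small K τ) (uA K t) (uB K t) (fun s => θ (lvl K s)))
      (fun K t τ => histShell (νB K t τ) (small K τ) (uB K t) (uA K t) (fun s => θ (lvl K s)))
      (fun K => ∑ s ∈ C K, DA (lvl K s) * ρ (lvl K s) + ∑ s ∈ C K, DB (lvl K s) * ρ (lvl K s)) := by
  haveI : ∀ K t s, IsFiniteMeasure (partialLaw (T K) (νA K t) (small K) (uA K t) (fun s => θ (lvl K s)) s) :=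
    fun K t s => isFiniteMeasure_partialLaw _ _ _ _ _ _
  haveI : ∀ K t s, IsFiniteMeasure (partialLaw (T K) (νB K t) (small K) (uB K t) (fun s => θ (lvl K s)) s) :=
    fun K t s => isFiniteMeasure_partialLaw _ _ _ _ _ _
  exact shellWeightBound_of_slotAC (ΩA := fun K _ => Ω K) (ΩB := fun K _ => Ω K)
    (μA := fun K t s => partialLaw (T K) (νA K t) (small K) (uA K t) (fun s => θ (lvl K s)) s)
    (μB := fun K t s => partialLaw (T K) (νB K t) (small K) (uB K t) (fun s => θ (lvl K s)) s)
    (uA := fun K t s => uA K t s) (uB := fun K t s => uB K t s) (θA := θ) (θB := θ)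
    (MA := fun _ _ _ => (1 : ℝ)) (MB := fun _ _ _ => (1 : ℝ))
    (pieceA := fun K t s τ => histPiece (νA K t τ) (small K τ) (uA K t) (uB K t) (fun s => θ (lvl K s)) s)
    (pieceB := fun K t s τ => histPiece (νB K t τ) (small K τ) (uB K t) (uA K t) (fun s => θ (lvl K s)) s)
    (sh_nonneg T small lvl νA uA uB θ l₀) (sh_le T small lvl νA uA uB θ l₀ huA)
    (cover T C small lvl νA uA uB θ l₀ huA huB hsmall) (ShellMeasureRootCompositionPushCubes.M_nonneg C l₀)
    (piece_le T C small lvl νA uA uB θ ρ l₀ huA hcloseA) (total_ge T C small lvl νA uA θ l₀ huA) hDA0 hρ0 hacA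
    (sh_nonneg T small lvl νB uB uA θ l₀) (sh_le T small lvl νB uB uA θ l₀ huB)
    (cover T C small lvl νB uB uA θ l₀ huB huA hsmall) (ShellMeasureRootCompositionPushCubes.M_nonneg C l₀)
    (piece_le T C small lvl νB uB uA θ ρ l₀ huB hcloseB) (total_ge T C small lvl νB uB θ l₀ huB) hDB0 hρ0 hacB
    hw hw hϑ0 hϑ1 hDA hDB hrate hrate

/-- **END-I, BAND FORM (road P2's head, c6)**: the same conclusion from `Summable ρ` and age-resolved live-slot counts
`#{s ∈ C K : K − lvl s = a} ≤ m a` (`a ≤ N₁`) in place of the geometric rate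
(`ShellMeasureRootComposition.shellWeightBound_of_slotAC_band`). [folklore] -/
theorem shellWeightBound_histories_band (huA : ∀ K t s, Measurable (uA K t s))
    (huB : ∀ K t s, Measurable (uB K t s)) (hsmall : ∀ K, ∀ τ ∈ T K, small K τ ⊆ C K)
    (hcloseA : ∀ K t, |t| ≤ l₀ → ∀ τ ∈ T K, ∀ s ∈ small K τ,
      ∀ᵐ ω ∂(νA K t τ), |uA K t s ω - uB K t s ω| ≤ ρ (lvl K s) * θ (lvl K s))
    (hcloseB : ∀ K t, |t| ≤ l₀ → ∀ τ ∈ T K, ∀ s ∈ small K τ,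
      ∀ᵐ ω ∂(νB K t τ), |uB K t s ω - uA K t s ω| ≤ ρ (lvl K s) * θ (lvl K s))
    (hDA0 : ∀ j, 0 ≤ DA j) (hDB0 : ∀ j, 0 ≤ DB j) (hρ0 : ∀ j, 0 ≤ ρ j)
    (hacA : ∀ K t, |t| ≤ l₀ → ∀ s ∈ C K,
      SlotAntiConcentration (partialLaw (T K) (νA K t) (small K) (uA K t) (fun s => θ (lvl K s)) s) (uA K t s)
        (θ (lvl K s)) (ρ (lvl K s)) (DA (lvl K s)))
    (hacB : ∀ K t, |t| ≤ l₀ → ∀ s ∈ C K,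
      SlotAntiConcentration (partialLaw (T K) (νB K t) (small K) (uB K t) (fun s => θ (lvl K s)) s) (uB K t s)
        (θ (lvl K s)) (ρ (lvl K s)) (DB (lvl K s)))
    (hw : LiveWindow C lvl N₁ νbar) (hDA : ∀ j, DA j ≤ Dbar) (hDB : ∀ j, DB j ≤ Dbar)
    (hm : ∀ K, ∀ a ≤ N₁, (((C K).filter fun s => K - lvl K s = a).card : ℝ) ≤ m a) (hρ : Summable ρ) :
    ShellWeightBound l₀ T
      (fun K t τ => histWeight (νA K t τ) (small K τ) (uA K t) (fun s => θ (lvl K s)))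
      (fun K t τ => histWeight (νB K t τ) (small K τ) (uB K t) (fun s => θ (lvl K s)))
      (fun K t τ => histShell (νA K t τ) (small K τ) (uA K t) (uB K t) (fun s => θ (lvl K s)))
      (fun K t τ => histShell (νB K t τ) (small K τ) (uB K t) (uA K t) (fun s => θ (lvl K s)))
      (fun K => ∑ s ∈ C K, DA (lvl K s) * ρ (lvl K s) + ∑ s ∈ C K, DB (lvl K s) * ρ (lvl K s)) := by
  haveI : ∀ K t s, IsFiniteMeasure (partialLaw (T K) (νA K t) (small K) (uA K t) (fun s => θ (lvl K s)) s) :=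
    fun K t s => isFiniteMeasure_partialLaw _ _ _ _ _ _
  haveI : ∀ K t s, IsFiniteMeasure (partialLaw (T K) (νB K t) (small K) (uB K t) (fun s => θ (lvl K s)) s) :=
    fun K t s => isFiniteMeasure_partialLaw _ _ _ _ _ _
  exact shellWeightBound_of_slotAC_band (ΩA := fun K _ => Ω K) (ΩB := fun K _ => Ω K)
    (μA := fun K t s => partialLaw (T K) (νA K t) (small K) (uA K t) (fun s => θ (lvl K s)) s)
    (μB := fun K t s => partialLaw (T K) (νB K t) (small K) (uB K t) (fun s => θ (lvl K s)) s)
    (uA := fun K t s => uA K t s) (uB := fun K t s => uB K t s) (θA := θ) (θB := θ)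
    (MA := fun _ _ _ => (1 : ℝ)) (MB := fun _ _ _ => (1 : ℝ))
    (pieceA := fun K t s τ => histPiece (νA K t τ) (small K τ) (uA K t) (uB K t) (fun s => θ (lvl K s)) s)
    (pieceB := fun K t s τ => histPiece (νB K t τ) (small K τ) (uB K t) (uA K t) (fun s => θ (lvl K s)) s)
    (sh_nonneg T small lvl νA uA uB θ l₀) (sh_le T small lvl νA uA uB θ l₀ huA)
    (cover T C small lvl νA uA uB θ l₀ huA huB hsmall) (ShellMeasureRootCompositionPushCubes.M_nonneg C l₀)
    (piece_le T C small lvl νA uA uB θ ρ l₀ huA hcloseA) (total_ge T C small lvl νA uA θ l₀ huA) hDA0 hρ0 hacA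
    (sh_nonneg T small lvl νB uB uA θ l₀) (sh_le T small lvl νB uB uA θ l₀ huB)
    (cover T C small lvl νB uB uA θ l₀ huB huA hsmall) (ShellMeasureRootCompositionPushCubes.M_nonneg C l₀)
    (piece_le T C small lvl νB uB uA θ ρ l₀ huB hcloseB) (total_ge T C small lvl νB uB θ l₀ huB) hDB0 hρ0 hacB
    hw hw hDA hDB hm hm hρ hρ

end TwoRuns

end Summit.QuantumFields.BalabanUV.T4Continuum.ShellMeasureRootCompositionHistoriesEnd

end
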